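import Summits.CriticalPhenomena.SAWScalingLimit.Theorems.SAWTotalPositivityBoundaryTP2Defs
import Summits.CriticalPhenomena.SAWScalingLimit.Theorems.SAWTotalPositivityBoundaryTP2Kernel
import Summits.CriticalPhenomena.SAWScalingLimit.Theorems.EdgeOfPositivity.Negative.EdgeOfPositivityRectDomain
import Literature.Probability.Percolation.PlanarDuality
import HarnessLib

/-!
# Crux `BoundaryTP2` (stmt-CriticalPhenomena-7115), line `Sketch`: stub `stub_rect_facingPairs`

Tool stub of the line's skeleton: on the box `R = discreteDomainGraph (rectDomain a b) 1`
(sites `{0..a} × {0..b}`, `a ≥ 1`) the quadruple `p₁ = (0,j₁)` above `p₂ = (0,j₂)` on the left side,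
`p₃ = (a,j₃)` below `p₄ = (a,j₄)` on the right side (cyclic order `p₁, p₂, p₃, p₄`;
`0 ≤ j₂ < j₁ ≤ b`, `0 ≤ j₃ < j₄ ≤ b`) satisfies the three hypotheses of the crux:

* (i) interlacing — every self-avoiding path `P : p₁ → p₃` meets every self-avoiding path
  `Q : p₂ → p₄`. EXTENSION TRICK: in `ℤ²`, prolong `P` by one horizontal step at each end into a
  left-right crossing of the big box `[-1, a+1] × [-1, b+1]`, and prolong `Q` by the runs
  `(-1,-1) ↑ (-1,j₂) → (0,j₂)` and `(a,j₄) → (a+1,j₄) ↑ (a+1,b+1)` into a bottom-top crossing of the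
  same box; the discrete Jordan lemma
  `Literature.Probability.Percolation.exists_mem_support_of_crossing` gives a common vertex, and the
  added vertices of either walk avoid the other walk (columns `-1`, `a+1` are off the box; on column
  `-1` the prolonged `Q` stays at heights `≤ j₂ < j₁`, on column `a+1` at heights `≥ j₄ > j₃`), so the
  common vertex is common to `P` and `Q`;
* (ii) `(p₁p₂ | p₃p₄)` is realised by the two side segments (columns `0` and `a`, disjoint as `a ≥ 1`);
* (iii) `(p₁p₄ | p₂p₃)` is realised over the top (`p₁ ↑ (0,b) → (a,b) ↓ p₄`) and under the bottom
  (`p₂ ↓ (0,0) → (a,0) ↑ p₃`), disjoint by coordinates.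
-/

noncomputable section

namespace Summit.CriticalPhenomena.SAWScalingLimit.Theorems.BoundaryTP2

open Literature.Probability.LatticeModels Literature.Probability.RandomPlanarGeometry
open Summit.CriticalPhenomena.SAWScalingLimit.Theorems.EdgeOfPositivity.Negative

/-! ### Straight runs with coordinate-controlled supports -/

/-- A vertical lattice segment `{i} × {m..n}` of `ℤ²` (`m ≤ n`) carries a lattice walk from `(i,m)` up
to `(i,n)` all of whose vertices lie on that segment. [folklore] -/
private theorem exists_zdColWalk (i m n : ℤ) (hmn : m ≤ n) :
    ∃ W : (zdGraph 2).Walk (st i m) (st i n), ∀ z ∈ W.support, z 0 = i ∧ m ≤ z 1 ∧ z 1 ≤ n := by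
  induction n, hmn using Int.leInduction with
  | base =>
    refine ⟨SimpleGraph.Walk.nil, fun z hz => ?_⟩
    rw [SimpleGraph.Walk.support_nil, List.mem_singleton] at hz
    subst hz
    rw [st_zero, st_one]
    exact ⟨rfl, le_rfl, le_rfl⟩
  | succ n hmn ih =>
    obtain ⟨W, hW⟩ := ih
    refine ⟨W.concat (zdGraph_adj_st_succ_right i n), fun z hz => ?_⟩
    rw [SimpleGraph.Walk.support_concat, List.mem_append, List.mem_singleton] at hz
    rcases hz with hz | rfl
    · have := hW z hz
      omega
    · rw [st_zero, st_one]
      omega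

/-- The vertical segment `{i} × {m..n}` of the box (`0 ≤ i ≤ a`, `0 ≤ m ≤ n ≤ b`) carries a walk of
the box graph from `(i,m)` up to `(i,n)` all of whose vertices lie on that segment. [folklore] -/
private theorem exists_boxColWalk (a b : ℕ) {i m n : ℤ} (hi0 : 0 ≤ i) (hia : i ≤ a) (hm : 0 ≤ m)
    (hmn : m ≤ n) (hn : n ≤ b) :
    ∃ W : (discreteDomainGraph (rectDomain a b) 1).Walk (st i m) (st i n),
      ∀ z ∈ W.support, z 0 = i ∧ m ≤ z 1 ∧ z 1 ≤ n := by
  induction n, hmn using Int.leInduction with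
  | base =>
    refine ⟨SimpleGraph.Walk.nil, fun z hz => ?_⟩
    rw [SimpleGraph.Walk.support_nil, List.mem_singleton] at hz
    subst hz
    rw [st_zero, st_one]
    exact ⟨rfl, le_rfl, le_rfl⟩
  | succ n hmn ih =>
    obtain ⟨W, hW⟩ := ih (by omega)
    have hadj : (discreteDomainGraph (rectDomain a b) 1).Adj (st i n) (st i (n + 1)) := by
      refine adj_rect_iff.2 ⟨zdGraph_adj_st_succ_right i n, ?_, ?_⟩
      · rw [mem_rectSites_iff, st_zero, st_one]; omega
      · rw [mem_rectSites_iff, st_zero, st_one]; omega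
    refine ⟨W.concat hadj, fun z hz => ?_⟩
    rw [SimpleGraph.Walk.support_concat, List.mem_append, List.mem_singleton] at hz
    rcases hz with hz | rfl
    · have := hW z hz
      omega
    · rw [st_zero, st_one]
      omega

/-- The horizontal segment `{0..n} × {j}` of the box (`0 ≤ j ≤ b`, `n ≤ a`) carries a walk of the box
graph from `(0,j)` rightwards to `(n,j)` all of whose vertices lie on that segment. [folklore] -/
private theorem exists_boxRowWalk (a b : ℕ) {j : ℤ} (hj0 : 0 ≤ j) (hjb : j ≤ b) :
    ∀ n : ℕ, n ≤ a →
      ∃ W : (discreteDomainGraph (rectDomain a b) 1).Walk (st 0 j) (st n j),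
        ∀ z ∈ W.support, z 1 = j ∧ 0 ≤ z 0 ∧ z 0 ≤ n := by
  -- adapted from `exists_rowWalk` in `…BoundaryTP2RectCornersDisjoint`
  intro n
  induction n with
  | zero =>
    intro _
    refine ⟨SimpleGraph.Walk.nil, fun z hz => ?_⟩
    rw [SimpleGraph.Walk.support_nil, List.mem_singleton] at hz
    subst hz
    simp
  | succ n ih =>
    intro hn
    obtain ⟨W, hW⟩ := ih (Nat.le_of_succ_le hn)
    have hadj : (discreteDomainGraph (rectDomain a b) 1).Adj (st n j) (st (n + 1 : ℕ) j) := by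
      refine adj_rect_iff.2 ⟨?_, ?_, ?_⟩
      · have := zdGraph_adj_st_succ_left n j
        push_cast
        exact this
      · rw [mem_rectSites_iff, st_zero, st_one]; omega
      · rw [mem_rectSites_iff, st_zero, st_one]; omega
    refine ⟨W.concat hadj, fun z hz => ?_⟩
    rw [SimpleGraph.Walk.support_concat, List.mem_append, List.mem_singleton] at hz
    rcases hz with hz | rfl
    · have := hW z hz
      omega
    · rw [st_zero, st_one]; omega

/-! ### (i) Interlacing by the extension trick -/

/-- On the box `{0..a} × {0..b}`, two sites `(0,j₁)` above `(0,j₂)` on the left side and two sites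
`(a,j₃)` below `(a,j₄)` on the right side are interlaced: every self-avoiding path `(0,j₁) → (a,j₃)`
of the box graph meets every self-avoiding path `(0,j₂) → (a,j₄)`. Proof: prolong the first (in
`ℤ²`) into a left-right crossing `(-1,j₁) → ⋯ → (a+1,j₃)` of `[-1,a+1] × [-1,b+1]` and the second
into a bottom-top crossing `(-1,-1) ↑ (-1,j₂) → ⋯ → (a+1,j₄) ↑ (a+1,b+1)`; the two crossings meet
(`exists_mem_support_of_crossing`), and the added vertices of each avoid the other. [folklore] -/
private theorem interlaced_facingPairs (a b : ℕ) {j₁ j₂ j₃ j₄ : ℤ}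
    (h₂ : 0 ≤ j₂) (h₂₁ : j₂ < j₁) (h₁ : j₁ ≤ b) (h₃ : 0 ≤ j₃) (h₃₄ : j₃ < j₄) (h₄ : j₄ ≤ b) :
    Interlaced (discreteDomainGraph (rectDomain a b) 1) (st 0 j₁) (st 0 j₂) (st a j₃) (st a j₄) := by
  intro P Q
  have hle : discreteDomainGraph (rectDomain a b) 1 ≤ zdGraph 2 :=
    discreteDomainGraph_le_zdGraph (rectDomain a b) 1
  have hp₁ : st 0 j₁ ∈ rectSites a b := by rw [mem_rectSites_iff, st_zero, st_one]; omega
  have hp₂ : st 0 j₂ ∈ rectSites a b := by rw [mem_rectSites_iff, st_zero, st_one]; omega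
  -- the original supports lie in the box `[0, a] × [0, b]`
  have hP₀ : ∀ z ∈ P.1.support, (0 : ℤ) ≤ z 0 ∧ z 0 ≤ (a : ℤ) ∧ (0 : ℤ) ≤ z 1 ∧ z 1 ≤ (b : ℤ) :=
    fun z hz => and_assoc.1 (mem_rectSites_iff.1 (support_subset_rectSites hp₁ P.1 z hz))
  have hQ₀ : ∀ z ∈ Q.1.support, (0 : ℤ) ≤ z 0 ∧ z 0 ≤ (a : ℤ) ∧ (0 : ℤ) ≤ z 1 ∧ z 1 ≤ (b : ℤ) :=
    fun z hz => and_assoc.1 (mem_rectSites_iff.1 (support_subset_rectSites hp₂ Q.1 z hz))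
  -- the four horizontal unit steps out of the box
  have e₁ : (zdGraph 2).Adj (st (-1) j₁) (st 0 j₁) := by
    have := zdGraph_adj_st_succ_left (-1) j₁
    rwa [neg_add_cancel] at this
  have e₂ : (zdGraph 2).Adj (st a j₃) (st (a + 1) j₃) := zdGraph_adj_st_succ_left a j₃
  have e₃ : (zdGraph 2).Adj (st (-1) j₂) (st 0 j₂) := by
    have := zdGraph_adj_st_succ_left (-1) j₂
    rwa [neg_add_cancel] at this
  have e₄ : (zdGraph 2).Adj (st a j₄) (st (a + 1) j₄) := zdGraph_adj_st_succ_left a j₄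
  -- the two vertical runs closing `Q` up into a bottom-top crossing of `[-1, a+1] × [-1, b+1]`
  obtain ⟨C₁, hC₁⟩ := exists_zdColWalk (-1) (-1) j₂ (by omega)
  obtain ⟨C₂, hC₂⟩ := exists_zdColWalk (a + 1) j₄ (b + 1) (by omega)
  -- the prolonged `P`: a left-right crossing of the big box
  obtain ⟨P', hP'⟩ : ∃ P' : (zdGraph 2).Walk (st (-1) j₁) (st (a + 1) j₃), ∀ z ∈ P'.support,
      z ∈ P.1.support ∨ (z 0 = -1 ∧ z 1 = j₁) ∨ (z 0 = a + 1 ∧ z 1 = j₃) := by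
    refine ⟨SimpleGraph.Walk.cons e₁ ((P.1.mapLe hle).concat e₂), fun z hz => ?_⟩
    rw [SimpleGraph.Walk.support_cons, List.mem_cons, SimpleGraph.Walk.support_concat,
      List.mem_append, List.mem_singleton, SimpleGraph.Walk.support_mapLe_eq_support] at hz
    rcases hz with rfl | hz | rfl
    · exact Or.inr (Or.inl ⟨st_zero _ _, st_one _ _⟩)
    · exact Or.inl hz
    · exact Or.inr (Or.inr ⟨st_zero _ _, st_one _ _⟩)
  -- the prolonged `Q`: a bottom-top crossing of the big box
  obtain ⟨Q', hQ'⟩ : ∃ Q' : (zdGraph 2).Walk (st (-1) (-1)) (st (a + 1) (b + 1)), ∀ z ∈ Q'.support,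
      z ∈ Q.1.support ∨ (z 0 = -1 ∧ -1 ≤ z 1 ∧ z 1 ≤ j₂) ∨
        (z 0 = a + 1 ∧ j₄ ≤ z 1 ∧ z 1 ≤ b + 1) := by
    refine ⟨C₁.append (SimpleGraph.Walk.cons e₃ (((Q.1.mapLe hle).concat e₄).append C₂)),
      fun z hz => ?_⟩
    rw [SimpleGraph.Walk.mem_support_append_iff, SimpleGraph.Walk.support_cons, List.mem_cons,
      SimpleGraph.Walk.mem_support_append_iff, SimpleGraph.Walk.support_concat, List.mem_append,
      List.mem_singleton, SimpleGraph.Walk.support_mapLe_eq_support] at hz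
    rcases hz with hz | rfl | (hz | rfl) | hz
    · exact Or.inr (Or.inl (hC₁ z hz))
    · refine Or.inr (Or.inl ?_)
      rw [st_zero, st_one]
      omega
    · exact Or.inl hz
    · refine Or.inr (Or.inr ?_)
      rw [st_zero, st_one]
      omega
    · exact Or.inr (Or.inr (hC₂ z hz))
  -- both prolonged walks stay in the big box
  have hP'box : ∀ z ∈ P'.support,
      (-1 : ℤ) ≤ z 0 ∧ z 0 ≤ (a : ℤ) + 1 ∧ (-1 : ℤ) ≤ z 1 ∧ z 1 ≤ (b : ℤ) + 1 := by
    intro z hz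
    rcases hP' z hz with hz | hz | hz
    · have := hP₀ z hz
      omega
    · omega
    · omega
  have hQ'box : ∀ z ∈ Q'.support,
      (-1 : ℤ) ≤ z 0 ∧ z 0 ≤ (a : ℤ) + 1 ∧ (-1 : ℤ) ≤ z 1 ∧ z 1 ≤ (b : ℤ) + 1 := by
    intro z hz
    rcases hQ' z hz with hz | hz | hz
    · have := hQ₀ z hz
      omega
    · omega
    · omega
  -- a left-right crossing meets a bottom-top crossing of the big box
  obtain ⟨z, hzP, hzQ⟩ := Literature.Probability.Percolation.exists_mem_support_of_crossing
    P' Q' hP'box hQ'box (st_zero _ _) (st_zero _ _) (st_one _ _) (st_one _ _)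
  -- the common vertex is a vertex of both original paths
  refine ⟨z, ?_⟩
  rcases hP' z hzP with hzP | hzP | hzP
  · rcases hQ' z hzQ with hzQ | hzQ | hzQ
    · exact ⟨hzP, hzQ⟩
    · exfalso
      have := hP₀ z hzP
      omega
    · exfalso
      have := hP₀ z hzP
      omega
  · exfalso
    rcases hQ' z hzQ with hzQ | hzQ | hzQ
    · have := hQ₀ z hzQ
      omega
    · omega
    · omega
  · exfalso
    rcases hQ' z hzQ with hzQ | hzQ | hzQ
    · have := hQ₀ z hzQ
      omega
    · omega
    · omega

/-! ### (ii), (iii) Disjoint realisations -/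

/-- On the box `{0..a} × {0..b}` with `a ≥ 1`, the pairing `((0,j₁)(0,j₂) | (a,j₃)(a,j₄))`
(`0 ≤ j₂ ≤ j₁ ≤ b`, `0 ≤ j₃ ≤ j₄ ≤ b`) is realised by vertex-disjoint self-avoiding paths of the box
graph: the segment of column `0` from `j₁` down to `j₂` and the segment of column `a` from `j₃` up to
`j₄` (disjoint as `a ≥ 1`). [folklore] -/
private theorem disjointPaths_facingPairs_sides (a b : ℕ) (ha : 1 ≤ a) {j₁ j₂ j₃ j₄ : ℤ}
    (h₂ : 0 ≤ j₂) (h₂₁ : j₂ ≤ j₁) (h₁ : j₁ ≤ b) (h₃ : 0 ≤ j₃) (h₃₄ : j₃ ≤ j₄) (h₄ : j₄ ≤ b) :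
    DisjointPaths (discreteDomainGraph (rectDomain a b) 1) (st 0 j₁) (st 0 j₂) (st a j₃) (st a j₄) := by
  obtain ⟨W₁, hW₁⟩ := exists_boxColWalk a b (i := 0) le_rfl (Nat.cast_nonneg a) h₂ h₂₁ h₁
  obtain ⟨W₂, hW₂⟩ := exists_boxColWalk a b (i := a) (Nat.cast_nonneg a) le_rfl h₃ h₃₄ h₄
  refine ⟨W₁.reverse.toPath, W₂.toPath, ?_⟩
  -- column `0` (first coordinate `0`) against column `a` (first coordinate `a ≥ 1`)
  intro z hz₁ hz₂
  have hz₁' := hW₁ z (by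
    have := W₁.reverse.support_toPath_subset_support hz₁
    rwa [SimpleGraph.Walk.support_reverse, List.mem_reverse] at this)
  have hz₂' := hW₂ z (W₂.support_toPath_subset_support hz₂)
  omega

/-- On the box `{0..a} × {0..b}` with `a ≥ 1`, the pairing `((0,j₁)(a,j₄) | (0,j₂)(a,j₃))`
(`0 ≤ j₂ < j₁ ≤ b`, `0 ≤ j₃ < j₄ ≤ b`) is realised by vertex-disjoint self-avoiding paths of the box
graph: over the top, `(0,j₁) ↑ (0,b) → (a,b) ↓ (a,j₄)` (column `0` at heights `≥ j₁`, row `b`,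
column `a` at heights `≥ j₄`), and under the bottom, `(0,j₂) ↓ (0,0) → (a,0) ↑ (a,j₃)` (column `0` at
heights `≤ j₂ < j₁`, row `0 < b`, column `a` at heights `≤ j₃ < j₄`). [folklore] -/
private theorem disjointPaths_facingPairs_around (a b : ℕ) (ha : 1 ≤ a) {j₁ j₂ j₃ j₄ : ℤ}
    (h₂ : 0 ≤ j₂) (h₂₁ : j₂ < j₁) (h₁ : j₁ ≤ b) (h₃ : 0 ≤ j₃) (h₃₄ : j₃ < j₄) (h₄ : j₄ ≤ b) :
    DisjointPaths (discreteDomainGraph (rectDomain a b) 1) (st 0 j₁) (st a j₄) (st 0 j₂) (st a j₃) := by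
  have ha0 : (0 : ℤ) ≤ a := Nat.cast_nonneg a
  have hb0 : (0 : ℤ) ≤ b := Nat.cast_nonneg b
  -- over the top: up column `0`, along row `b`, down column `a`
  obtain ⟨U₁, hU₁⟩ := exists_boxColWalk a b (i := 0) le_rfl ha0 (by omega : (0 : ℤ) ≤ j₁) h₁ le_rfl
  obtain ⟨R₁, hR₁⟩ := exists_boxRowWalk a b (j := b) hb0 le_rfl a le_rfl
  obtain ⟨D₁, hD₁⟩ := exists_boxColWalk a b (i := a) ha0 le_rfl (by omega : (0 : ℤ) ≤ j₄) h₄ le_rfl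
  -- under the bottom: down column `0`, along row `0`, up column `a`
  obtain ⟨U₂, hU₂⟩ := exists_boxColWalk a b (i := 0) le_rfl ha0 le_rfl h₂ (by omega : j₂ ≤ (b : ℤ))
  obtain ⟨R₂, hR₂⟩ := exists_boxRowWalk a b (j := 0) le_rfl hb0 a le_rfl
  obtain ⟨D₂, hD₂⟩ := exists_boxColWalk a b (i := a) ha0 le_rfl le_rfl h₃ (by omega : j₃ ≤ (b : ℤ))
  refine ⟨((U₁.append R₁).append D₁.reverse).toPath, ((U₂.reverse.append R₂).append D₂).toPath, ?_⟩
  intro z hz₁ hz₂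
  have hz₁' := SimpleGraph.Walk.support_toPath_subset_support _ hz₁
  have hz₂' := SimpleGraph.Walk.support_toPath_subset_support _ hz₂
  simp only [SimpleGraph.Walk.mem_support_append_iff, SimpleGraph.Walk.support_reverse,
    List.mem_reverse] at hz₁' hz₂'
  -- coordinates of the two supports
  have key₁ : (z 0 = 0 ∧ j₁ ≤ z 1) ∨ z 1 = b ∨ (z 0 = a ∧ j₄ ≤ z 1) := by
    rcases hz₁' with (hz | hz) | hz
    · exact Or.inl ⟨(hU₁ z hz).1, (hU₁ z hz).2.1⟩
    · exact Or.inr (Or.inl (hR₁ z hz).1)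
    · exact Or.inr (Or.inr ⟨(hD₁ z hz).1, (hD₁ z hz).2.1⟩)
  have key₂ : (z 0 = 0 ∧ z 1 ≤ j₂) ∨ z 1 = 0 ∨ (z 0 = a ∧ z 1 ≤ j₃) := by
    rcases hz₂' with (hz | hz) | hz
    · exact Or.inl ⟨(hU₂ z hz).1, (hU₂ z hz).2.2⟩
    · exact Or.inr (Or.inl (hR₂ z hz).1)
    · exact Or.inr (Or.inr ⟨(hD₂ z hz).1, (hD₂ z hz).2.2⟩)
  rcases key₁ with h | h | h <;> rcases key₂ with h' | h' | h' <;> omega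

/-! ### The registered stub -/

/-- **Tool stub `stub_rect_facingPairs`.** On the box `{0..a}×{0..b}` with `a ≥ 1`: two sites
`p₁ = (0,j₁)` above `p₂ = (0,j₂)` on the left side against two sites `p₃ = (a,j₃)` below
`p₄ = (a,j₄)` on the right side (cyclic order `p₁, p₂, p₃, p₄`) satisfy all three hypotheses of the
crux: interlacing (extension trick + the discrete Jordan lemma
`Literature.Probability.Percolation.exists_mem_support_of_crossing`) and disjoint realisability of
`(p₁p₂ | p₃p₄)` (the two side segments) and of `(p₁p₄ | p₂p₃)` (over the top / under the bottom).
[folklore] -/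
theorem stub_rect_facingPairs (a b : ℕ) (ha : 1 ≤ a) {j₁ j₂ j₃ j₄ : ℤ}
    (h₂ : 0 ≤ j₂) (h₂₁ : j₂ < j₁) (h₁ : j₁ ≤ b) (h₃ : 0 ≤ j₃) (h₃₄ : j₃ < j₄) (h₄ : j₄ ≤ b) :
    Interlaced (discreteDomainGraph (rectDomain a b) 1) (st 0 j₁) (st 0 j₂) (st a j₃) (st a j₄) ∧
    DisjointPaths (discreteDomainGraph (rectDomain a b) 1) (st 0 j₁) (st 0 j₂) (st a j₃) (st a j₄) ∧
    DisjointPaths (discreteDomainGraph (rectDomain a b) 1) (st 0 j₁) (st a j₄) (st 0 j₂) (st a j₃) :=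
  ⟨interlaced_facingPairs a b h₂ h₂₁ h₁ h₃ h₃₄ h₄,
    disjointPaths_facingPairs_sides a b ha h₂ h₂₁.le h₁ h₃ h₃₄.le h₄,
    disjointPaths_facingPairs_around a b ha h₂ h₂₁ h₁ h₃ h₃₄ h₄⟩

end Summit.CriticalPhenomena.SAWScalingLimit.Theorems.BoundaryTP2
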